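import Summits.Ventures.PercRepro2.CaseOneGadgetUWA1OMainIIT
import Summits.Ventures.PercRepro2.CaseOneGadgetUWA1OMainIT
import Summits.Ventures.PercRepro2.CaseOneGadgetUWA1OAnchor
import Summits.Ventures.PercRepro2.CaseOneGadgetUWA1AnchorT

/-!
# The gadget `u ~ {w, a₁, o}`, `w ~ {u, a₂, b}` (uwa1o) is an anchor of the six-form calculus
(blind cell PercRepro2, p1 g34; the FOURTH gadget anchor of the six-form calculus — the first whose six forms are ALL
plain SFacts-cone chains, kits j317114 / j318477 / j319447, P1-G33 §6–§6″)

With `(ii-T)` / `(i-T)` at `u` for the uwa1o gadget (`zSplitIIT_of_gadgetUWA1O` / `zSplitIT_of_gadgetUWA1O`,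
CaseOneGadgetUWA1OMainIIT / MainIT) next to its four forms (`fourForms_of_gadgetUWA1O`, CaseOneGadgetUWA1OAnchor):
**`sixForms_of_gadgetUWA1O`**, **`closedAtT_of_gadgetUWA1O`**, **`closedAtT_of_gadgetUWA1OAnchor`**. The anchor
set of the six-form calculus grows by `GadgetUWA1OAnchor`: `ClosedAnchorTGO := ClosedAnchorTG ∨ GadgetUWA1OAnchor`
(`= ClosedAnchorTM ∨ GadgetUWOAnchor ∨ GadgetUWA1Anchor ∨ GadgetUWA1OAnchor`, CaseOneGadgetUWA1AnchorT),
**`closedAtT_of_closedAnchorTGO`**, the `a₂`-free residual core `InCoreTGO` relative to it (and to its faces,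
`ClosedAnchorTGOF` / `InCoreTGOF`) and the reductions **`closedAtT_of_coreTGO`** / **`closedAtT_of_coreTGOF`**.
Own code; standard axioms. -/

namespace Summit.Ventures.PercRepro2

namespace CaseOne

universe u

section GadgetUWA1OT
variable {V : Type*} {E : Type*} [Fintype E] [DecidableEq E] [Fintype V] [DecidableEq V]
  {R : Type*} [Field R] [LinearOrder R] [IsStrictOrderedRing R]
variable {ends : E → Sym2 V} {o a₁ a₂ b u w : V} {euw eua1 euo ewa2 ewb : E}

/-- **The six forms at `u` for the uwa1o gadget**, every finite graph, every weight vector. -/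
theorem sixForms_of_gadgetUWA1O (p : E → R) (hp : IsProbVec p)
    (h : IsGadgetUWA1O ends o a₁ a₂ b u w euw eua1 euo ewa2 ewb) : SixForms p ends o a₁ a₂ u b := by
  obtain ⟨k1, k2, k3, k4⟩ := fourForms_of_gadgetUWA1O p hp h
  exact ⟨k1, k2, zSplitIIT_of_gadgetUWA1O p hp h, k3, k4, zSplitIT_of_gadgetUWA1O p hp h⟩

/-- **The uwa1o gadget is an anchor of the six-form calculus.** -/
theorem closedAtT_of_gadgetUWA1O (h : IsGadgetUWA1O ends o a₁ a₂ b u w euw eua1 euo ewa2 ewb) :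
    ClosedAtT (R := R) o a₁ a₂ b E ends u :=
  fun p hp => sixForms_of_gadgetUWA1O p hp h

end GadgetUWA1OT

section AnchorsTGO
variable {V : Type*}

/-- **The anchors of the six-form calculus with the three gadgets uwo, uwa1, uwa1o**: `ClosedAnchorTG`
(`= ClosedAnchorTM` or a uwo- or uwa1-gadget anchor) or a uwa1o-gadget anchor. -/
def ClosedAnchorTGO (o a₁ a₂ b : V) (E : Type u) (ends : E → Sym2 V) (v : V) : Prop :=
  ClosedAnchorTG o a₁ a₂ b E ends v ∨ GadgetUWA1OAnchor o a₁ a₂ b E ends v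

variable (o a₁ a₂ b : V) [Fintype V] [DecidableEq V] {R : Type*} [Field R] [LinearOrder R]
  [IsStrictOrderedRing R]

/-- **A uwa1o-gadget anchor is six-form closed.** -/
theorem closedAtT_of_gadgetUWA1OAnchor (E : Type u) [Fintype E] [DecidableEq E] (ends : E → Sym2 V)
    (v : V) (h : GadgetUWA1OAnchor o a₁ a₂ b E ends v) : ClosedAtT (R := R) o a₁ a₂ b E ends v := by
  obtain ⟨w, euw, eua1, euo, ewa2, ewb, h⟩ := h
  exact closedAtT_of_gadgetUWA1O h

/-- **A `ClosedAnchorTGO` anchor is six-form closed.** -/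
theorem closedAtT_of_closedAnchorTGO (E : Type u) [Fintype E] [DecidableEq E] (ends : E → Sym2 V)
    (v : V) (h : ClosedAnchorTGO o a₁ a₂ b E ends v) : ClosedAtT (R := R) o a₁ a₂ b E ends v := by
  rcases h with h | h
  · exact closedAtT_of_closedAnchorTG o a₁ a₂ b E ends v h
  · exact closedAtT_of_gadgetUWA1OAnchor o a₁ a₂ b E ends v h

variable (v : V)

/-- **The `a₂`-free residual core relative to `ClosedAnchorTGO`.** -/
def InCoreTGO (E : Type u) [Fintype E] [DecidableEq E] (ends : E → Sym2 V) : Prop :=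
  InCoreTAnc o a₁ a₂ b v (fun E₀ _ _ ends₀ v₀ => ClosedAnchorTGO o a₁ a₂ b E₀ ends₀ v₀) E ends

/-- **The reduction to the `a₂`-free residual core with the three gadgets among the anchors.** -/
theorem closedAtT_of_coreTGO
    (hcore : ∀ (E' : Type u) [Fintype E'] [DecidableEq E'] (ends' : E' → Sym2 V),
      InCoreTGO o a₁ a₂ b v E' ends' → ClosedAtT (R := R) o a₁ a₂ b E' ends' v) :
    ∀ (E : Type u) [Fintype E] [DecidableEq E] (ends : E → Sym2 V),
      ClosedAtT (R := R) o a₁ a₂ b E ends v :=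
  closedAtT_of_coreTAnc o a₁ a₂ b v _
    (fun E₀ _ _ ends₀ v₀ h => closedAtT_of_closedAnchorTGO o a₁ a₂ b E₀ ends₀ v₀ h) hcore

/-- **The anchors with the three gadgets and all their faces.** -/
def ClosedAnchorTGOF (E : Type u) [Fintype E] [DecidableEq E] (ends : E → Sym2 V) (v : V) : Prop :=
  ∃ n : ℕ, FaceAnchorN (fun E₀ _ _ ends₀ v₀ => ClosedAnchorTGO o a₁ a₂ b E₀ ends₀ v₀) n E ends v

/-- **A `ClosedAnchorTGOF` anchor is six-form closed.** -/
theorem closedAtT_of_closedAnchorTGOF (E : Type u) [Fintype E] [DecidableEq E] (ends : E → Sym2 V)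
    (v : V) (h : ClosedAnchorTGOF o a₁ a₂ b E ends v) : ClosedAtT (R := R) o a₁ a₂ b E ends v := by
  obtain ⟨n, hn⟩ := h
  exact closedAtT_of_faceAnchorN o a₁ a₂ b _
    (fun E₀ _ _ ends₀ v₀ h₀ => closedAtT_of_closedAnchorTGO o a₁ a₂ b E₀ ends₀ v₀ h₀) n E ends v hn

/-- **The `a₂`-free residual core relative to the anchors with the three gadgets and their faces.** -/
def InCoreTGOF (E : Type u) [Fintype E] [DecidableEq E] (ends : E → Sym2 V) : Prop :=
  InCoreTAnc o a₁ a₂ b v (fun E₀ _ _ ends₀ v₀ => ClosedAnchorTGOF o a₁ a₂ b E₀ ends₀ v₀) E ends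

/-- **The reduction to `InCoreTGOF`.** -/
theorem closedAtT_of_coreTGOF
    (hcore : ∀ (E' : Type u) [Fintype E'] [DecidableEq E'] (ends' : E' → Sym2 V),
      InCoreTGOF o a₁ a₂ b v E' ends' → ClosedAtT (R := R) o a₁ a₂ b E' ends' v) :
    ∀ (E : Type u) [Fintype E] [DecidableEq E] (ends : E → Sym2 V),
      ClosedAtT (R := R) o a₁ a₂ b E ends v :=
  closedAtT_of_coreTAnc o a₁ a₂ b v _
    (fun E₀ _ _ ends₀ v₀ h => closedAtT_of_closedAnchorTGOF o a₁ a₂ b E₀ ends₀ v₀ h) hcore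

end AnchorsTGO

end CaseOne

end Summit.Ventures.PercRepro2
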